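import Literature.AlgebraicGeometry.Motives.MixedHodgeExtensionTate
import Literature.AlgebraicGeometry.Motives.MixedHodgeExtensionInternalHom
import HarnessLib

/-!
# `Ext¹(ℚ(0), Hom(A, B)) ≅ Ext¹(A, B)` for separated mixed Hodge structures

Carlson, *Extensions of mixed Hodge structures* (1980), §2(a)–(b): the lattice `Hom(B, A)` "supports a
canonical mixed Hodge structure", `J^p H = H_ℂ/(F^p H + H_ℤ)`, and Prop. 2: `Ext(B, A) ≅ J⁰Hom(B, A)`,
the `0`-th Jacobian OF THE INTERNAL HOM. Combining the tree's identifications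

* `Ext.tateEquivJacobianRat : Ext(ℚ(-p), H) ≃ J^p(H)_ℚ` (`MixedHodgeExtensionTate`, here `p = 0`,
  `H = Hom(A, B)`, applicable because a separated pair has `W_{-1} Hom(A, B) = Hom(A, B)`:
  `hom_W_neg_one_eq_top`),
* `jacobianRatHomEquivJHom : J⁰(Hom(A, B))_ℚ ≃ₗ J⁰Hom(A, B)` (`MixedHodgeExtensionInternalHom`),
* `extEquivJHom : Ext(A, B) ≃ J⁰Hom(A, B)` (`MixedHodgeExtensionCongruence`, Carlson Prop. 2),

gives **`Ext.unitInternalHomEquiv : Ext(ℚ(0), Hom(A, B)) ≃ Ext(A, B)`** — extensions of `A` by `B`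
are the same as extensions of the unit object `ℚ(0)` by the internal Hom (the `Ext¹`-analogue of
Deligne–Milne, *Tannakian categories*, (1.6.4) `Hom(1, Hom(X, Y)) = Hom(X, Y)`, whose `Hom`-version is
the tree's `unitHomHomEquiv`), characterised by: the invariant in `J⁰(Hom(A, B))_ℚ` of an extension
of `ℚ(0)` by `Hom(A, B)` is the `clsJacobian` of the corresponding extension of `A` by `B`
(`clsJacobian_eq_evalClass_of_unitInternalHomEquiv`).

## Main results (all proved; no named facts)

* `hom_W_neg_one_eq_top` — separated `A`, `B` ⟹ `W_{-1} Hom(A, B) = Hom(A, B)` (all weights `< 0`).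
* `Ext.unitInternalHomEquiv`, `Ext.cls_unitInternalHomEquiv_mk`, `Ext.unitInternalHomEquiv_symm_mk`,
  `clsJacobian_eq_evalClass_of_unitInternalHomEquiv`.

## References

* [Carlson1980] J. A. Carlson, Extensions of mixed Hodge structures (1980), §2(a)–(b), Prop. 2 (held
  text `book:beauvillend-proceedings-indo-french-conference-geometry`, PDF pp. 88–89).
* [DeligneMilne1982Tannakian] P. Deligne, J. S. Milne, Tannakian categories, LNM 900, §1 (1.6.4).
-/

open scoped TensorProduct

noncomputable section

namespace Literature.AlgebraicGeometry.Motives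

namespace MixedHodgeStructure

open HodgeStructure (tate)

universe u v

variable {VA : Type u} [AddCommGroup VA] [Module ℚ VA] [FiniteDimensional ℚ VA]
variable {VB : Type v} [AddCommGroup VB] [Module ℚ VB] [FiniteDimensional ℚ VB]
variable (A : MixedHodgeStructure VA) (B : MixedHodgeStructure VB)

/-- **A separated pair has `W_{-1} Hom(A, B) = Hom(A, B)`**: if `W_m B = B` and `W_m A = 0`, every
`f : A → B` maps `W_n A` into `W_{n-1} B` (for `n ≤ m` the source step is `0`, for `n > m` the target
step is everything) — "the highest weight of `A` is less than the lowest weight of `B`" makes all weights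
of `Hom(B, A)` negative (Carlson §2(b); El Zein–Lê §3.2.2.7 (2)(ii), `mem_hom_W_iff`).
[cite: Carlson1980, §2(b)] -/
theorem hom_W_neg_one_eq_top (hsep : IsSeparated A B) : (hom A B).W (-1) = ⊤ := by
  obtain ⟨m, hBm, hAm⟩ := hsep
  refine eq_top_iff.2 fun f _ => (mem_hom_W_iff A B (-1) f).2 fun n => ?_
  by_cases hn : n ≤ m
  · have h0 : A.W n = ⊥ := eq_bot_iff.2 (hAm ▸ A.monotone_W hn)
    rw [h0, Submodule.map_bot]
    exact bot_le
  · have h1 : B.W (n + -1) = ⊤ := eq_top_iff.2 (hBm ▸ B.monotone_W (by omega))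
    rw [h1]
    exact le_top

/-- The separation hypothesis of `Ext.tateEquivJacobianRat` for `p = 0`, `H = Hom(A, B)`.
[cite: Carlson1980, §2(b)] -/
theorem hom_W_two_mul_zero_sub_one_eq_top (hsep : IsSeparated A B) : (hom A B).W (2 * 0 - 1) = ⊤ :=
  hom_W_neg_one_eq_top A B hsep

/-- **`Ext¹(ℚ(0), Hom(A, B)) ≅ Ext¹(A, B)`** for separated `A`, `B`: through `J⁰(Hom(A, B))_ℚ ≅
J⁰Hom(A, B)` (Carlson 1980, §2(b), Prop. 2: `Ext(B, A) ≅ J⁰Hom(B, A)` with `Hom` the internal Hom).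
[cite: Carlson1980, §2(b) Prop. 2] [cite: DeligneMilne1982Tannakian, §1 (1.6.4)] -/
def Ext.unitInternalHomEquiv (hsep : IsSeparated A B) :
    Ext (tate (-0)).toMixedHodgeStructure (hom A B) ≃ Ext A B :=
  (Ext.tateEquivJacobianRat (hom A B) 0 (hom_W_two_mul_zero_sub_one_eq_top A B hsep)).trans
    ((jacobianRatHomEquivJHom A B).toEquiv.trans (extEquivJHom hsep).symm)

/-- The class in `J⁰Hom(A, B)` of the image of `[F]`, `F` an extension of `ℚ(0)` by `Hom(A, B)`: the
invariant of `F` at `1` carried through `J⁰(Hom(A, B))_ℚ ≅ J⁰Hom(A, B)`. [cite: Carlson1980, §2(b) Prop. 2] -/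
theorem Ext.cls_unitInternalHomEquiv_mk (hsep : IsSeparated A B)
    (F : Extension (tate (-0)).toMixedHodgeStructure (hom A B) (ℚ × (VA →ₗ[ℚ] VB))) :
    Ext.cls (Ext.unitInternalHomEquiv A B hsep (Ext.mk F)) =
      jacobianRatHomEquivJHom A B (F.evalClass (ofRat_one_mem_tate_F 0)) := by
  change extEquivJHom hsep ((extEquivJHom hsep).symm _) = _
  rw [Equiv.apply_symm_apply]
  rfl

/-- Backwards: an extension `E` of `A` by `B` (on `VA × VB`) goes to the class of extensions of `ℚ(0)` by
`Hom(A, B)` whose invariant in `J⁰(Hom(A, B))_ℚ` is `E.clsJacobian`. [cite: Carlson1980, §2(b) Prop. 2] -/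
theorem Ext.unitInternalHomEquiv_symm_mk (hsep : IsSeparated A B) (E : Extension A B (VA × VB)) :
    (Ext.unitInternalHomEquiv A B hsep).symm (Ext.mk E) =
      (Ext.tateEquivJacobianRat (hom A B) 0 (hom_W_two_mul_zero_sub_one_eq_top A B hsep)).symm
        E.clsJacobian := by
  change (Ext.tateEquivJacobianRat (hom A B) 0 (hom_W_two_mul_zero_sub_one_eq_top A B hsep)).symm
    ((jacobianRatHomEquivJHom A B).toEquiv.symm (extEquivJHom hsep (Ext.mk E))) = _
  rfl

/-- For a representative `F` of the class corresponding to `E`: the invariant of `F` in `J⁰(Hom(A, B))_ℚ`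
is `E.clsJacobian` (Carlson's class read in the Jacobian of the internal Hom). [cite: Carlson1980, §2(b) Prop. 2] -/
theorem clsJacobian_eq_evalClass_of_unitInternalHomEquiv (hsep : IsSeparated A B) (E : Extension A B (VA × VB))
    (F : Extension (tate (-0)).toMixedHodgeStructure (hom A B) (ℚ × (VA →ₗ[ℚ] VB)))
    (h : Ext.unitInternalHomEquiv A B hsep (Ext.mk F) = Ext.mk E) :
    F.evalClass (ofRat_one_mem_tate_F 0) = E.clsJacobian := by
  have h' := congrArg Ext.cls h
  rw [Ext.cls_unitInternalHomEquiv_mk, Ext.cls_mk] at h'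
  rw [Extension.clsJacobian, ← h', LinearEquiv.symm_apply_apply]

end MixedHodgeStructure

end Literature.AlgebraicGeometry.Motives

end
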